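import Literature.MathematicalPhysics.QuantumFieldTheory.Balaban1983to89.B6RandomWalkL2

/-!
# `Balaban1983to89.B9Eq365DifferenceMajorants` — [Balaban1985BackgroundPropagators] p. 403 (3.65) *«G′(U′U) = G′(U) +
# G′(U)V′(A)G′(U′U) = G′(U) + G′(U′U)V′(A)G′(U), and norms of the second operators on the right-hand sides are small»*
# READ FOR COMPOSITE OPERATORS: the block-majorant ALGEBRA OF DIFFERENCES (products, two-sided inverses, exponential
# kernels) that carries a «small difference at two backgrounds» from `G`, `Q`, `∂` to the minimizer operator
# `H = GQ*(QGQ*)⁻¹` (3.126) and to the linearised curvature `T = ∂∘H` of [Balaban1989LargeFieldII] (1.7)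

statement-level skeleton of published theorems with citation tags; proofs where landed; nothing here is a claim about
the Yang–Mills mass gap.

Cell pub-ymgap, HUMAN RULING D-0062, seat `pub-ymgap-dag-n12-b` (item of record [DAGLEAD-G0-REBALANCE-15]: the [13] =
[B9] Sect. B cross-paper LETTER behind the first-order error `E_A` of [LF-II] (1.7); announced [DAGN12B-G0-ANNOUNCE-B9-DIFF]).
T. Bałaban, *Propagators for lattice gauge theories in a background field*, Commun. Math. Phys. **99** (1985) 389–434
[Balaban1985BackgroundPropagators] (B9; PDF held `paper:balaban1985-cmp99-background-propagators`, journal page = PDF page +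
388); the block calculus is [Balaban1984PropagatorsII] (2.51)–(2.55) p. 232–233, Lemma 2.1 (2.61)/(2.63) p. 234, in p22's
`ℓ²` form `B6RandomWalkL2` (`HasL2Majorant`, `hasL2Majorant_mul`, `hasL2Majorant_add`).  CONSUMER: this seat's
`B16Ineq17MinimizerError.ineq17_of_majorants_only` (hypothesis `hKA`: the DIFFERENCE of the linearised curvatures at the
backgrounds `e^{iξA₀}` and `1` has a block majorant `≤ C_B·m·e^{−δd}`, `m` the size of `A₀`).  TYPED NEIGHBOURS of the
`G`-difference letter: r06's `B9Thm34Ext.remainder_entry1` (sup shape, first entry) and n06-b's `B9SectBAllNorms.sectB_left_remainder`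
((3.65)'s remainder «with the additional small factor» over arbitrary `B11SectG.BlockNorm`s, p410861).

THE PRINT (verbatim).  p. 402–403 [PDF 14–15]: *«the operator V′(A)G′(U) satisfies the bound |(V′(A)G′(U)λ)(x)| ≦
O(1)B₀α₁e^{−δ₀d(y,y′)} (3.63) for x ∈ Δ(y), supp λ ⊂ Δ(y′) … What is more important we have G′(U′U) = G′(U) +
G′(U)V′(A)G′(U′U) = G′(U) + G′(U′U)V′(A)G′(U), (3.65) and norms of the second operators on the right-hand sides are small.
Now applying Theorem 3.1 for G′(U), the bound (3.63), the representation (3.64) and Lemma 2.1 of [4] we can prove all the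
statements (3.42)–(3.47) of Theorem 3.1 for the operator G′(U′U), of course with different constants, although changes are
small.»*  p. 420 [PDF 32]: *«They imply the formula HB = GQ*(QGQ*)⁻¹B. (3.126)»*  [4] p. 232: *«this property is preserved
under the composition of operators possessing it … A summation preserves it also»*; (2.54) *«d(y, y₁) + … + d(y_{n−1}, y′) ≧
d(y, y′)»*; (2.61) *«sup_y Σ_{y′} e^{−αδ₀d(y,y′)} ≦ c₁(α)»*.

WHAT IS PROVED (0 `sorry`, no `def`, no new `Prop`; Mathlib + `B6RandomWalkL2`; axioms standard; generic over
`g : B6.Geometry`, a finite lattice `X` with block map `blk : X → g.Site`, endomorphisms `Module.End ℝ (X → ℝ)`).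
§1 `conv_exp_le` — CONVOLUTION OF EXPONENTIAL KERNELS with rate bookkeeping: `K₁ ≤ C₁e^{−δ₁d}`, `K₂ ≤ C₂e^{−δ₂d}`, a target
   rate `δ′ ≤ δ₂`, the triangle inequality (2.54) and the row sum `Σ_{y″}e^{−(δ₁−δ′)d(y,y″)} ≤ c` give
   `Σ_{y″}K₁(y,y″)K₂(y″,y′) ≤ C₁C₂c·e^{−δ′d(y,y′)}` (the step behind «of course with different constants»).
§2 `hasL2Majorant_sub_mul` — DIFFERENCE OF PRODUCTS: `T₁S₁ − T₀S₀ = (T₁ − T₀)S₁ + T₀(S₁ − S₀)`, majorant = the two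
   convolutions (`hasL2Majorant_mul` + `hasL2Majorant_add` by name); `hasL2Majorant_sub_mul_exp` — with exponential letters:
   factors `≤ C_S, C_T·e^{−δd}`, differences `≤ θ_D, θ_E·e^{−δd}` ⇒ the product difference `≤ (θ_DC_S + C_Tθ_E)c·e^{−δ′d}`;
   `hasL2Majorant_mul_exp` (products), `hasL2Majorant_sub_mul3_exp` — THREE factors (e.g. `QGQ*`), two rate steps.
§3 `hasL2Majorant_sub_inv` — DIFFERENCE OF INVERSES ON A SUBSPACE (`B₁A₁ = P = A₀B₀`, `B₁P = B₁`, `PB₀ = B₀`; resolvent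
   identity `B₁ − B₀ = −B₁(A₁ − A₀)B₀`, private):
   majorant = the triple convolution; `hasL2Majorant_sub_inv_exp` — exponential letters ⇒ `≤ C²θc²·e^{−δ″d}`.
§4 `hasL2Majorant_hOp_sub` — **H = GE at two backgrounds** (`E := Q*(QGQ*)⁻¹` the extension factor of (3.126)):
   `H₁ − H₀ = (G₁ − G₀)E₁ + G₀(E₁ − E₀)` with exponential letters ⇒ `H₁ − H₀ ≺ 2Cθc·e^{−δ′d}` — the shape (3.65) read for
   `H`; `hasL2Majorant_curvature_sub` — the same for `T = ∂H` with the LOCAL difference letter of the covariant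
   derivative, landing in the consumer's shape `K_A ≤ (C_B·θ)·e^{−δ_Ad}`.
HONEST SCOPE.  The letters — majorants of `G`, `Q*`, `(QGQ*)⁻¹`, `∂` at each background (Theorems 3.1–3.4 ∕ Cor. 3.5–3.6
of B9: `B9.Ineq342_346_347`-shape) and the DIFFERENCE letters (`G`: (3.65) with (3.63), shape of r06's
`B9Thm34Ext.remainder_entry1`; `Q`, `Q*`, `∂`: local operators, `O(1)ηα₁` on the diagonal blocks, (3.15)/(3.60);
`(QGQ*)⁻¹`: by §3 from the former) — are HYPOTHESES of printed shape; what is PROVED is the algebra carrying them to `H` and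
`∂H`.  The sup shape of B9's own statements passes to the block-`ℓ²` shape by p22's `B6RandomWalkL2Schur` (not re-done
here).  Count-neutral; NOT summit progress.
-/

noncomputable section

open scoped BigOperators
open Finset

namespace Literature.MathematicalPhysics.QuantumFieldTheory.Balaban1983to89.B9Eq365DifferenceMajorants

open B6RandomWalk (blockPiece sum_blockPiece)
open B6RandomWalkL2 (l2n l2n_nonneg l2n_zero HasL2Majorant hasL2Majorant_mono hasL2Majorant_add hasL2Majorant_mul)

variable {g : B6.Geometry} {X : Type} [Fintype X] (blk : X → g.Site)

/-! ## §1. Convolution of exponential kernels -/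

/-- **Convolution of exponential kernels, with the rate bookkeeping of (3.64)–(3.66)**: `0 ≤ K₁ ≤ C₁e^{−δ₁d}`,
`0 ≤ K₂ ≤ C₂e^{−δ₂d}`, a target rate `0 ≤ δ′ ≤ δ₂`, the triangle inequality (2.54) of [4] and the row sum
`Σ_{y″}e^{−(δ₁−δ′)d(y,y″)} ≤ c` ((2.61) at the rate `δ₁ − δ′`, so `δ′ < δ₁` in any use) give `Σ_{y″}K₁(y,y″)K₂(y″,y′) ≤ C₁C₂c·e^{−δ′d(y,y′)}`
(split `e^{−δ₁d₁−δ₂d₂} ≤ e^{−δ′(d₁+d₂)}e^{−(δ₁−δ′)d₁} ≤ e^{−δ′d(y,y′)}e^{−(δ₁−δ′)d₁}`).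
[cite: Balaban1984PropagatorsII, (2.54) p.233, (2.61) p.234; Balaban1985BackgroundPropagators, p.403 («applying … Lemma 2.1
of [4] … of course with different constants»)] -/
theorem conv_exp_le {K₁ K₂ : g.Site → g.Site → ℝ} {C₁ C₂ δ₁ δ₂ δ' c : ℝ} (hC₁ : 0 ≤ C₁) (hC₂ : 0 ≤ C₂)
    (hK₂0 : ∀ a b, 0 ≤ K₂ a b)
    (hK₁ : ∀ a b, K₁ a b ≤ C₁ * Real.exp (-(δ₁ * g.dist a b)))
    (hK₂ : ∀ a b, K₂ a b ≤ C₂ * Real.exp (-(δ₂ * g.dist a b)))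
    (hδ' : 0 ≤ δ') (h2 : δ' ≤ δ₂) (hd : ∀ a b, 0 ≤ g.dist a b)
    (htri : ∀ a b e, g.dist a e ≤ g.dist a b + g.dist b e)
    (hrow : ∀ y, ∑ y'' : g.Site, Real.exp (-((δ₁ - δ') * g.dist y y'')) ≤ c) (y y' : g.Site) :
    ∑ y'' : g.Site, K₁ y y'' * K₂ y'' y' ≤ C₁ * C₂ * c * Real.exp (-(δ' * g.dist y y')) := by
  -- pointwise: `K₁(y,y″)K₂(y″,y′) ≤ C₁C₂ e^{−δ′d(y,y′)} e^{−(δ₁−δ′)d(y,y″)}`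
  have hpt : ∀ y'', K₁ y y'' * K₂ y'' y' ≤
      C₁ * C₂ * Real.exp (-(δ' * g.dist y y')) * Real.exp (-((δ₁ - δ') * g.dist y y'')) := by
    intro y''
    have e1 : Real.exp (-(δ₁ * g.dist y y'')) * Real.exp (-(δ₂ * g.dist y'' y')) ≤
        Real.exp (-(δ' * g.dist y y')) * Real.exp (-((δ₁ - δ') * g.dist y y'')) := by
      rw [← Real.exp_add, ← Real.exp_add]
      refine Real.exp_le_exp.mpr ?_
      have ht := htri y y'' y'
      have hd2 := hd y'' y'
      nlinarith [mul_le_mul_of_nonneg_left ht hδ', mul_nonneg (sub_nonneg.mpr h2) hd2]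
    calc K₁ y y'' * K₂ y'' y'
        ≤ (C₁ * Real.exp (-(δ₁ * g.dist y y''))) * (C₂ * Real.exp (-(δ₂ * g.dist y'' y'))) :=
          mul_le_mul (hK₁ _ _) (hK₂ _ _) (hK₂0 _ _) (mul_nonneg hC₁ (Real.exp_pos _).le)
      _ = C₁ * C₂ * (Real.exp (-(δ₁ * g.dist y y'')) * Real.exp (-(δ₂ * g.dist y'' y'))) := by ring
      _ ≤ C₁ * C₂ * (Real.exp (-(δ' * g.dist y y')) * Real.exp (-((δ₁ - δ') * g.dist y y''))) :=
          mul_le_mul_of_nonneg_left e1 (mul_nonneg hC₁ hC₂)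
      _ = C₁ * C₂ * Real.exp (-(δ' * g.dist y y')) * Real.exp (-((δ₁ - δ') * g.dist y y'')) := by ring
  have hfac : 0 ≤ C₁ * C₂ * Real.exp (-(δ' * g.dist y y')) := by positivity
  calc ∑ y'' : g.Site, K₁ y y'' * K₂ y'' y'
      ≤ ∑ y'' : g.Site, C₁ * C₂ * Real.exp (-(δ' * g.dist y y')) * Real.exp (-((δ₁ - δ') * g.dist y y'')) :=
        Finset.sum_le_sum fun y'' _ => hpt y''
    _ = C₁ * C₂ * Real.exp (-(δ' * g.dist y y')) * ∑ y'' : g.Site, Real.exp (-((δ₁ - δ') * g.dist y y'')) := by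
        rw [Finset.mul_sum]
    _ ≤ C₁ * C₂ * Real.exp (-(δ' * g.dist y y')) * c := mul_le_mul_of_nonneg_left (hrow y) hfac
    _ = C₁ * C₂ * c * Real.exp (-(δ' * g.dist y y')) := by ring

/-! ## §2. Differences of products -/

/-- **Difference of products**: `T₁S₁ − T₀S₀ = (T₁ − T₀)S₁ + T₀(S₁ − S₀)`; with block-`ℓ²` majorants `K_D ≥ 0` of
`T₁ − T₀`, `K_{S₁}` of `S₁`, `K_{T₀} ≥ 0` of `T₀` and `K_E` of `S₁ − S₀`, the difference has the majorant
`Σ_{y″}K_D(y,y″)K_{S₁}(y″,y′) + Σ_{y″}K_{T₀}(y,y″)K_E(y″,y′)` (composition (2.55) and summation, by name).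
[cite: Balaban1984PropagatorsII, (2.52)–(2.55) p.232; Balaban1985BackgroundPropagators, (3.65) p.403] -/
theorem hasL2Majorant_sub_mul {T₀ T₁ S₀ S₁ : Module.End ℝ (X → ℝ)} {KD KS KT KE : g.Site → g.Site → ℝ}
    (hD : HasL2Majorant blk (T₁ - T₀) KD) (hS : HasL2Majorant blk S₁ KS) (hT : HasL2Majorant blk T₀ KT)
    (hE : HasL2Majorant blk (S₁ - S₀) KE) (hKD : ∀ a b, 0 ≤ KD a b) (hKT : ∀ a b, 0 ≤ KT a b) :
    HasL2Majorant blk (T₁ * S₁ - T₀ * S₀)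
      (fun a b => (∑ y'' : g.Site, KD a y'' * KS y'' b) + ∑ y'' : g.Site, KT a y'' * KE y'' b) := by
  have halg : T₁ * S₁ - T₀ * S₀ = (T₁ - T₀) * S₁ + T₀ * (S₁ - S₀) := by
    rw [sub_mul, mul_sub]; abel
  rw [halg]
  exact hasL2Majorant_add blk (hasL2Majorant_mul blk hD hS hKD) (hasL2Majorant_mul blk hT hE hKT)

/-- **Difference of products with exponential letters**: factors `S₁ ≺ C_Se^{−δd}`, `T₀ ≺ C_Te^{−δd}`, differences
`T₁ − T₀ ≺ θ_De^{−δd}`, `S₁ − S₀ ≺ θ_Ee^{−δd}` (all kernels `≥ 0`, constants `≥ 0`), target rate `0 ≤ δ′ ≤ δ` and the row sum of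
`e^{−(δ−δ′)d}` bounded by `c` ⇒ `T₁S₁ − T₀S₀ ≺ (θ_DC_S + C_Tθ_E)c·e^{−δ′d}`. [cite: Balaban1985BackgroundPropagators, (3.63)–(3.65) pp.402–403; Balaban1984PropagatorsII,
(2.61) p.234] -/
theorem hasL2Majorant_sub_mul_exp {T₀ T₁ S₀ S₁ : Module.End ℝ (X → ℝ)} {KD KS KT KE : g.Site → g.Site → ℝ}
    (hD : HasL2Majorant blk (T₁ - T₀) KD) (hS : HasL2Majorant blk S₁ KS) (hT : HasL2Majorant blk T₀ KT)
    (hE : HasL2Majorant blk (S₁ - S₀) KE) (hKD0 : ∀ a b, 0 ≤ KD a b) (hKS0 : ∀ a b, 0 ≤ KS a b)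
    (hKT0 : ∀ a b, 0 ≤ KT a b) (hKE0 : ∀ a b, 0 ≤ KE a b) {CS CT θD θE δ δ' c : ℝ} (hCS : 0 ≤ CS) (hCT : 0 ≤ CT)
    (hθD : 0 ≤ θD) (hθE : 0 ≤ θE)
    (hKD : ∀ a b, KD a b ≤ θD * Real.exp (-(δ * g.dist a b))) (hKS : ∀ a b, KS a b ≤ CS * Real.exp (-(δ * g.dist a b)))
    (hKT : ∀ a b, KT a b ≤ CT * Real.exp (-(δ * g.dist a b))) (hKE : ∀ a b, KE a b ≤ θE * Real.exp (-(δ * g.dist a b)))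
    (hδ' : 0 ≤ δ') (hle : δ' ≤ δ) (hd : ∀ a b, 0 ≤ g.dist a b) (htri : ∀ a b e, g.dist a e ≤ g.dist a b + g.dist b e)
    (hrow : ∀ y, ∑ y'' : g.Site, Real.exp (-((δ - δ') * g.dist y y'')) ≤ c) :
    HasL2Majorant blk (T₁ * S₁ - T₀ * S₀) (fun a b => (θD * CS + CT * θE) * c * Real.exp (-(δ' * g.dist a b))) := by
  refine hasL2Majorant_mono blk (hasL2Majorant_sub_mul blk hD hS hT hE hKD0 hKT0) fun a b => ?_
  have h1 := conv_exp_le (K₁ := KD) (K₂ := KS) hθD hCS hKS0 hKD hKS hδ' hle hd htri hrow a b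
  have h2 := conv_exp_le (K₁ := KT) (K₂ := KE) hCT hθE hKE0 hKT hKE hδ' hle hd htri hrow a b
  have e : θD * CS * c * Real.exp (-(δ' * g.dist a b)) + CT * θE * c * Real.exp (-(δ' * g.dist a b)) =
      (θD * CS + CT * θE) * c * Real.exp (-(δ' * g.dist a b)) := by ring
  linarith

/-- The product of two operators with exponential majorants `≺ C_Te^{−δd}`, `≺ C_Se^{−δd}` has `≺ C_TC_Sc·e^{−δ′d}` (one
rate step). [cite: Balaban1984PropagatorsII, (2.55) p.232, (2.61) p.234] -/
theorem hasL2Majorant_mul_exp {T S : Module.End ℝ (X → ℝ)} {KT KS : g.Site → g.Site → ℝ}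
    (hT : HasL2Majorant blk T KT) (hS : HasL2Majorant blk S KS) (hKT0 : ∀ a b, 0 ≤ KT a b) (hKS0 : ∀ a b, 0 ≤ KS a b)
    {CT CS δ δ' c : ℝ} (hCT : 0 ≤ CT) (hCS : 0 ≤ CS)
    (hKT : ∀ a b, KT a b ≤ CT * Real.exp (-(δ * g.dist a b))) (hKS : ∀ a b, KS a b ≤ CS * Real.exp (-(δ * g.dist a b)))
    (hδ' : 0 ≤ δ') (hle : δ' ≤ δ) (hd : ∀ a b, 0 ≤ g.dist a b) (htri : ∀ a b e, g.dist a e ≤ g.dist a b + g.dist b e)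
    (hrow : ∀ y, ∑ y'' : g.Site, Real.exp (-((δ - δ') * g.dist y y'')) ≤ c) :
    HasL2Majorant blk (T * S) (fun a b => CT * CS * c * Real.exp (-(δ' * g.dist a b))) :=
  hasL2Majorant_mono blk (hasL2Majorant_mul blk hT hS hKT0) fun a b =>
    conv_exp_le (K₁ := KT) (K₂ := KS) hCT hCS hKS0 hKT hKS hδ' hle hd htri hrow a b

/-- **Difference of TRIPLE products with exponential letters** (e.g. `Q₁G₁Q₁* − Q₀G₀Q₀*`): `T₁S₁R₁ − T₀S₀R₀ =
(T₁S₁ − T₀S₀)R₁ + T₀S₀(R₁ − R₀)`; letters `T₀ ≺ C_T`, `S₁, S₀ ≺ C_S`, `R₁ ≺ C_R` (times `e^{−δd}`), differences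
`≺ θ_T, θ_S, θ_R` (times `e^{−δd}`); two rate steps `δ ≥ δ′ ≥ δ″ ≥ 0` with row sums `≤ c` ⇒
`≺ ((θ_TC_S + C_Tθ_S)c·C_R + C_TC_Sc·θ_R)·c·e^{−δ″d}`. [cite: Balaban1984PropagatorsII, (2.52)–(2.55) p.232, (2.61) p.234;
Balaban1985BackgroundPropagators, (3.65) p.403] -/
theorem hasL2Majorant_sub_mul3_exp {T₀ T₁ S₀ S₁ R₀ R₁ : Module.End ℝ (X → ℝ)}
    {KdT KS₁ KT₀ KdS KS₀ KR₁ KdR : g.Site → g.Site → ℝ}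
    (hdT : HasL2Majorant blk (T₁ - T₀) KdT) (hS₁ : HasL2Majorant blk S₁ KS₁) (hT₀ : HasL2Majorant blk T₀ KT₀)
    (hdS : HasL2Majorant blk (S₁ - S₀) KdS) (hS₀ : HasL2Majorant blk S₀ KS₀) (hR₁ : HasL2Majorant blk R₁ KR₁)
    (hdR : HasL2Majorant blk (R₁ - R₀) KdR)
    (hKdT0 : ∀ a b, 0 ≤ KdT a b) (hKS₁0 : ∀ a b, 0 ≤ KS₁ a b) (hKT₀0 : ∀ a b, 0 ≤ KT₀ a b) (hKdS0 : ∀ a b, 0 ≤ KdS a b)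
    (hKS₀0 : ∀ a b, 0 ≤ KS₀ a b) (hKR₁0 : ∀ a b, 0 ≤ KR₁ a b) (hKdR0 : ∀ a b, 0 ≤ KdR a b)
    {CT CS CR θT θS θR δ δ' δ'' c : ℝ} (hCT : 0 ≤ CT) (hCS : 0 ≤ CS) (hCR : 0 ≤ CR) (hθT : 0 ≤ θT) (hθS : 0 ≤ θS)
    (hθR : 0 ≤ θR) (hc : 0 ≤ c)
    (hKdT : ∀ a b, KdT a b ≤ θT * Real.exp (-(δ * g.dist a b))) (hKS₁ : ∀ a b, KS₁ a b ≤ CS * Real.exp (-(δ * g.dist a b)))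
    (hKT₀ : ∀ a b, KT₀ a b ≤ CT * Real.exp (-(δ * g.dist a b))) (hKdS : ∀ a b, KdS a b ≤ θS * Real.exp (-(δ * g.dist a b)))
    (hKS₀ : ∀ a b, KS₀ a b ≤ CS * Real.exp (-(δ * g.dist a b))) (hKR₁ : ∀ a b, KR₁ a b ≤ CR * Real.exp (-(δ * g.dist a b)))
    (hKdR : ∀ a b, KdR a b ≤ θR * Real.exp (-(δ * g.dist a b)))
    (hδ'' : 0 ≤ δ'') (hδ21 : δ'' ≤ δ') (hδ10 : δ' ≤ δ) (hd : ∀ a b, 0 ≤ g.dist a b)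
    (htri : ∀ a b e, g.dist a e ≤ g.dist a b + g.dist b e)
    (hrow₁ : ∀ y, ∑ y'' : g.Site, Real.exp (-((δ - δ') * g.dist y y'')) ≤ c)
    (hrow₂ : ∀ y, ∑ y'' : g.Site, Real.exp (-((δ' - δ'') * g.dist y y'')) ≤ c) :
    HasL2Majorant blk (T₁ * S₁ * R₁ - T₀ * S₀ * R₀)
      (fun a b => ((θT * CS + CT * θS) * c * CR + CT * CS * c * θR) * c * Real.exp (-(δ'' * g.dist a b))) := by
  have hδ' : 0 ≤ δ' := hδ''.trans hδ21
  -- the inner difference and the inner product at rate δ′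
  have hin := hasL2Majorant_sub_mul_exp blk hdT hS₁ hT₀ hdS hKdT0 hKS₁0 hKT₀0 hKdS0 hCS hCT hθT hθS hKdT hKS₁ hKT₀
    hKdS hδ' hδ10 hd htri hrow₁
  have hprod := hasL2Majorant_mul_exp blk hT₀ hS₀ hKT₀0 hKS₀0 hCT hCS hKT₀ hKS₀ hδ' hδ10 hd htri hrow₁
  -- the outer letters at rate δ′
  have hKR₁' : ∀ a b, KR₁ a b ≤ CR * Real.exp (-(δ' * g.dist a b)) := fun a b =>
    (hKR₁ a b).trans (mul_le_mul_of_nonneg_left (Real.exp_le_exp.mpr (by nlinarith [hd a b])) hCR)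
  have hKdR' : ∀ a b, KdR a b ≤ θR * Real.exp (-(δ' * g.dist a b)) := fun a b =>
    (hKdR a b).trans (mul_le_mul_of_nonneg_left (Real.exp_le_exp.mpr (by nlinarith [hd a b])) hθR)
  have h0in : ∀ a b, 0 ≤ (θT * CS + CT * θS) * c * Real.exp (-(δ' * g.dist a b)) := fun a b => by positivity
  have h0pr : ∀ a b, 0 ≤ CT * CS * c * Real.exp (-(δ' * g.dist a b)) := fun a b => by positivity
  exact hasL2Majorant_sub_mul_exp blk (T₀ := T₀ * S₀) (T₁ := T₁ * S₁) (S₀ := R₀) (S₁ := R₁) hin hR₁ hprod hdR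
    h0in hKR₁0 h0pr hKdR0 hCR (by positivity) (by positivity) hθR (fun a b => le_rfl) hKR₁' (fun a b => le_rfl) hKdR'
    hδ'' hδ21 hd htri hrow₂

/-! ## §3. Differences of two-sided inverses -/

omit [Fintype X] in
/-- **Resolvent identity** (private plumbing), in the PROJECTED form needed for operators that are inverses on a subspace
only (e.g. `(QGQ*)⁻¹` on the coarse lattice embedded in `X`): if `B₁A₁ = P`, `A₀B₀ = P`, `B₁P = B₁`, `PB₀ = B₀` then
`B₁ − B₀ = −(B₁(A₁ − A₀)B₀)` (with `P = 1` the usual two-sided case). [folklore] -/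
private theorem inv_sub_inv_eq {A₀ A₁ B₀ B₁ P : Module.End ℝ (X → ℝ)} (h₁ : B₁ * A₁ = P) (h₀ : A₀ * B₀ = P)
    (hB₁P : B₁ * P = B₁) (hPB₀ : P * B₀ = B₀) : B₁ - B₀ = -(B₁ * (A₁ - A₀) * B₀) := by
  have e : B₁ * (A₁ - A₀) * B₀ = B₁ * A₁ * B₀ - B₁ * (A₀ * B₀) := by
    rw [mul_sub, sub_mul, mul_assoc B₁ A₀ B₀]
  rw [e, h₁, h₀, hPB₀, hB₁P]
  abel

/-- A majorant of `T` is a majorant of `−T` (`‖Δ(y)(−Tu)‖ = ‖Δ(y)Tu‖`). [cite: Balaban1984PropagatorsII, (2.52) p.232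
(bookkeeping, ours)] -/
theorem hasL2Majorant_neg {T : Module.End ℝ (X → ℝ)} {K : g.Site → g.Site → ℝ} (h : HasL2Majorant blk T K) :
    HasL2Majorant blk (-T) K := by
  intro y y' u hu
  have e : blockPiece blk y ((-T) u) = -(blockPiece blk y (T u)) := by
    funext x
    by_cases hx : blk x = y <;> simp [blockPiece, hx]
  rw [e]
  have hn : l2n (-(blockPiece blk y (T u))) = l2n (blockPiece blk y (T u)) := by
    unfold l2n; simp [norm_neg]
  rw [hn]
  exact h y y' u hu

/-- **Difference of inverses (on a subspace)**: `B₁A₁ = P`, `A₀B₀ = P`, `B₁P = B₁`, `PB₀ = B₀` (`P = 1`: two-sided inverses;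
`P` = the projection onto the coarse lattice for `(QGQ*)⁻¹`); with majorants `K_{B₁} ≥ 0`, `K_D ≥ 0` (of `A₁ − A₀`), `K_{B₀}`,
the difference `B₁ − B₀` has the triple convolution `Σ_{y₁,y₂}K_{B₁}(y,y₁)K_D(y₁,y₂)K_{B₀}(y₂,y′)` as majorant.
[cite: Balaban1985BackgroundPropagators, (3.64)–(3.65) pp.402–403; Balaban1984PropagatorsII, (2.55) p.232] -/
theorem hasL2Majorant_sub_inv {A₀ A₁ B₀ B₁ P : Module.End ℝ (X → ℝ)} (h₁ : B₁ * A₁ = P) (h₀ : A₀ * B₀ = P)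
    (hB₁P : B₁ * P = B₁) (hPB₀ : P * B₀ = B₀)
    {KB₁ KD KB₀ : g.Site → g.Site → ℝ} (hB₁ : HasL2Majorant blk B₁ KB₁) (hD : HasL2Majorant blk (A₁ - A₀) KD)
    (hB₀ : HasL2Majorant blk B₀ KB₀) (hKB₁ : ∀ a b, 0 ≤ KB₁ a b) (hKD : ∀ a b, 0 ≤ KD a b) :
    HasL2Majorant blk (B₁ - B₀)
      (fun a b => ∑ y₂ : g.Site, (∑ y₁ : g.Site, KB₁ a y₁ * KD y₁ y₂) * KB₀ y₂ b) := by
  rw [inv_sub_inv_eq h₁ h₀ hB₁P hPB₀]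
  refine hasL2Majorant_neg blk ?_
  have h12 := hasL2Majorant_mul blk hB₁ hD hKB₁
  have hK12 : ∀ a b, 0 ≤ ∑ y₁ : g.Site, KB₁ a y₁ * KD y₁ b :=
    fun a b => Finset.sum_nonneg fun y₁ _ => mul_nonneg (hKB₁ _ _) (hKD _ _)
  exact hasL2Majorant_mul blk h12 hB₀ hK12

/-- **Difference of inverses (on a subspace) with exponential letters**: `B₁, B₀ ≺ Ce^{−δd}`, `A₁ − A₀ ≺ θe^{−δd}`, two rate
steps `δ ≥ δ′ ≥ δ″ ≥ 0` with row sums of `e^{−(δ−δ′)d}` and `e^{−(δ′−δ″)d}` bounded by `c` ⇒ `B₁ − B₀ ≺ C²θc²·e^{−δ″d}`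
(«the inverse is given by a convergent Neumann series … of course with different constants»).
[cite: Balaban1985BackgroundPropagators, (3.64)–(3.66) pp.402–403; Balaban1984PropagatorsII, (2.61) p.234] -/
theorem hasL2Majorant_sub_inv_exp {A₀ A₁ B₀ B₁ P : Module.End ℝ (X → ℝ)} (h₁ : B₁ * A₁ = P) (h₀ : A₀ * B₀ = P)
    (hB₁P : B₁ * P = B₁) (hPB₀ : P * B₀ = B₀)
    {KB₁ KD KB₀ : g.Site → g.Site → ℝ} (hB₁ : HasL2Majorant blk B₁ KB₁) (hD : HasL2Majorant blk (A₁ - A₀) KD)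
    (hB₀ : HasL2Majorant blk B₀ KB₀) (hKB₁0 : ∀ a b, 0 ≤ KB₁ a b) (hKD0 : ∀ a b, 0 ≤ KD a b)
    (hKB₀0 : ∀ a b, 0 ≤ KB₀ a b) {C θ δ δ' δ'' c : ℝ} (hC : 0 ≤ C) (hθ : 0 ≤ θ) (hc : 0 ≤ c)
    (hKB₁ : ∀ a b, KB₁ a b ≤ C * Real.exp (-(δ * g.dist a b)))
    (hKD : ∀ a b, KD a b ≤ θ * Real.exp (-(δ * g.dist a b)))
    (hKB₀ : ∀ a b, KB₀ a b ≤ C * Real.exp (-(δ * g.dist a b)))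
    (hδ'' : 0 ≤ δ'') (h''' : δ'' ≤ δ') (h'δ : δ' ≤ δ) (hd : ∀ a b, 0 ≤ g.dist a b)
    (htri : ∀ a b e, g.dist a e ≤ g.dist a b + g.dist b e)
    (hrow₁ : ∀ y, ∑ y'' : g.Site, Real.exp (-((δ - δ') * g.dist y y'')) ≤ c)
    (hrow₂ : ∀ y, ∑ y'' : g.Site, Real.exp (-((δ' - δ'') * g.dist y y'')) ≤ c) :
    HasL2Majorant blk (B₁ - B₀) (fun a b => C ^ 2 * θ * c ^ 2 * Real.exp (-(δ'' * g.dist a b))) := by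
  refine hasL2Majorant_mono blk (hasL2Majorant_sub_inv blk h₁ h₀ hB₁P hPB₀ hB₁ hD hB₀ hKB₁0 hKD0) fun a b => ?_
  have hδ' : 0 ≤ δ' := hδ''.trans h'''
  -- inner convolution at rate δ′
  have hin : ∀ a' b', ∑ y₁ : g.Site, KB₁ a' y₁ * KD y₁ b' ≤ C * θ * c * Real.exp (-(δ' * g.dist a' b')) :=
    fun a' b' => conv_exp_le (K₁ := KB₁) (K₂ := KD) hC hθ hKD0 hKB₁ hKD hδ' h'δ hd htri hrow₁ a' b'
  -- `KB₀` at rate δ is also at rate δ′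
  have hKB₀' : ∀ a' b', KB₀ a' b' ≤ C * Real.exp (-(δ' * g.dist a' b')) := by
    intro a' b'
    refine (hKB₀ a' b').trans (mul_le_mul_of_nonneg_left (Real.exp_le_exp.mpr ?_) hC)
    nlinarith [hd a' b']
  -- outer convolution at rate δ″
  have hout := conv_exp_le (K₁ := fun a' b' => ∑ y₁ : g.Site, KB₁ a' y₁ * KD y₁ b') (K₂ := KB₀)
    (by positivity : 0 ≤ C * θ * c) hC hKB₀0 hin hKB₀' hδ'' h''' hd htri hrow₂ a b
  calc ∑ y₂ : g.Site, (∑ y₁ : g.Site, KB₁ a y₁ * KD y₁ y₂) * KB₀ y₂ b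
      ≤ C * θ * c * C * c * Real.exp (-(δ'' * g.dist a b)) := hout
    _ = C ^ 2 * θ * c ^ 2 * Real.exp (-(δ'' * g.dist a b)) := by ring

/-! ## §4. `H = GQ*(QGQ*)⁻¹` and `∂H` at two backgrounds -/

/-- **(3.65) read for the minimizer operator `H = G·E`** (`E := Q*(QGQ*)⁻¹`, the extension factor of (3.126)):
`H₁ − H₀ = (G₁ − G₀)E₁ + G₀(E₁ − E₀)`.  Letters: `E₁, G₀ ≺ Ce^{−δd}` (Theorems 3.1–3.3 at each background, Cor. 3.6 for
`(QGQ*)⁻¹`), differences `G₁ − G₀ ≺ θe^{−δd}` ((3.65) with (3.63): `θ = O(1)B₀α₁`, shape of `B9Thm34Ext.remainder_entry1`)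
and `E₁ − E₀ ≺ θe^{−δd}` (from the local letter of `Q*` and `hasL2Majorant_sub_inv_exp` for `(QGQ*)⁻¹`), target rate
`δ′ ≤ δ`, row sum `c` ⇒ `H₁ − H₀ ≺ 2Cθc·e^{−δ′d}`. [cite: Balaban1985BackgroundPropagators, (3.65) p.403, (3.126) p.420] -/
theorem hasL2Majorant_hOp_sub {G₀ G₁ E₀ E₁ : Module.End ℝ (X → ℝ)} {KD KE₁ KG₀ KF : g.Site → g.Site → ℝ}
    (hD : HasL2Majorant blk (G₁ - G₀) KD) (hE₁ : HasL2Majorant blk E₁ KE₁) (hG₀ : HasL2Majorant blk G₀ KG₀)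
    (hF : HasL2Majorant blk (E₁ - E₀) KF) (hKD0 : ∀ a b, 0 ≤ KD a b) (hKE₁0 : ∀ a b, 0 ≤ KE₁ a b)
    (hKG₀0 : ∀ a b, 0 ≤ KG₀ a b) (hKF0 : ∀ a b, 0 ≤ KF a b) {C θ δ δ' c : ℝ} (hC : 0 ≤ C) (hθ : 0 ≤ θ)
    (hKD : ∀ a b, KD a b ≤ θ * Real.exp (-(δ * g.dist a b))) (hKE₁ : ∀ a b, KE₁ a b ≤ C * Real.exp (-(δ * g.dist a b)))
    (hKG₀ : ∀ a b, KG₀ a b ≤ C * Real.exp (-(δ * g.dist a b))) (hKF : ∀ a b, KF a b ≤ θ * Real.exp (-(δ * g.dist a b)))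
    (hδ' : 0 ≤ δ') (hle : δ' ≤ δ) (hd : ∀ a b, 0 ≤ g.dist a b) (htri : ∀ a b e, g.dist a e ≤ g.dist a b + g.dist b e)
    (hrow : ∀ y, ∑ y'' : g.Site, Real.exp (-((δ - δ') * g.dist y y'')) ≤ c) :
    HasL2Majorant blk (G₁ * E₁ - G₀ * E₀) (fun a b => 2 * C * θ * c * Real.exp (-(δ' * g.dist a b))) := by
  have h := hasL2Majorant_sub_mul_exp blk hD hE₁ hG₀ hF hKD0 hKE₁0 hKG₀0 hKF0 hC hC hθ hθ hKD hKE₁ hKG₀ hKF hδ' hle hd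
    htri hrow
  refine hasL2Majorant_mono blk h fun a b => le_of_eq ?_
  ring

/-- **The linearised curvature `T = ∂H` at two backgrounds** (the operator of [LF-II] (1.7)'s quadratic form): with the LOCAL
difference letter of the covariant derivative (`∂₁ − ∂₀ ≺ θe^{−δd}` — in print `|∂_{U′U} − ∂_U| ≤ O(1)ηα₁` on the diagonal
blocks), `∂₁, H₀`-letters `≺ Ce^{−δd}` and the `H`-difference `≺ θe^{−δd}` of `hasL2Majorant_hOp_sub` (re-lettered), one
more rate step gives `∂₁H₁ − ∂₀H₀ ≺ 2Cθc·e^{−δ′d}` — the consumer's hypothesis `hKA` of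
`B16Ineq17MinimizerError.ineq17_of_majorants_only` with `C_B·m := 2Cθc` (`θ ∝ m = α₁`, the size of `A₀`).
[cite: Balaban1989LargeFieldII, p.357 («up to the first order in A₀ … Sect. B [13]»); Balaban1985BackgroundPropagators,
(3.65) p.403] -/
theorem hasL2Majorant_curvature_sub {D₀ D₁ H₀ H₁ : Module.End ℝ (X → ℝ)} {KdD KH₁ KD₀ KdH : g.Site → g.Site → ℝ}
    (hdD : HasL2Majorant blk (D₁ - D₀) KdD) (hH₁ : HasL2Majorant blk H₁ KH₁) (hD₀ : HasL2Majorant blk D₀ KD₀)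
    (hdH : HasL2Majorant blk (H₁ - H₀) KdH) (hKdD0 : ∀ a b, 0 ≤ KdD a b) (hKH₁0 : ∀ a b, 0 ≤ KH₁ a b)
    (hKD₀0 : ∀ a b, 0 ≤ KD₀ a b) (hKdH0 : ∀ a b, 0 ≤ KdH a b) {C θ δ δ' c : ℝ} (hC : 0 ≤ C) (hθ : 0 ≤ θ)
    (hKdD : ∀ a b, KdD a b ≤ θ * Real.exp (-(δ * g.dist a b))) (hKH₁ : ∀ a b, KH₁ a b ≤ C * Real.exp (-(δ * g.dist a b)))
    (hKD₀ : ∀ a b, KD₀ a b ≤ C * Real.exp (-(δ * g.dist a b))) (hKdH : ∀ a b, KdH a b ≤ θ * Real.exp (-(δ * g.dist a b)))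
    (hδ' : 0 ≤ δ') (hle : δ' ≤ δ) (hd : ∀ a b, 0 ≤ g.dist a b) (htri : ∀ a b e, g.dist a e ≤ g.dist a b + g.dist b e)
    (hrow : ∀ y, ∑ y'' : g.Site, Real.exp (-((δ - δ') * g.dist y y'')) ≤ c) :
    HasL2Majorant blk (D₁ * H₁ - D₀ * H₀) (fun a b => 2 * C * θ * c * Real.exp (-(δ' * g.dist a b))) := by
  have h := hasL2Majorant_sub_mul_exp blk hdD hH₁ hD₀ hdH hKdD0 hKH₁0 hKD₀0 hKdH0 hC hC hθ hθ hKdD hKH₁ hKD₀ hKdH hδ'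
    hle hd htri hrow
  refine hasL2Majorant_mono blk h fun a b => le_of_eq ?_
  ring

/-! ## §5 (v1.1). THE ASSEMBLY: `(QGQ*)⁻¹`, `H = GQ*(QGQ*)⁻¹` and `∂H` at two backgrounds from the printed letters

READING OF RECORD for the consumer `B16Ineq17MinimizerError.ineq17_of_majorants_only` (answering dag-ref-B READ-45's located
ask): at the small background `U′ = e^{iξA₀}` the operator `T₁` there IS `∂_{U′} ∘ H_{U′}` — the covariant curvature linearisation
composed with the minimizer operator AT `U′`, the quadratic form being read as `Σ_p ζ₀(p)|(∂_{U′}H_{U′}B′)(p)|²` (i.e. `Δ₁(ζ₀) =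
∂_{U′}^* ζ₀ ∂_{U′}`); the background-curvature commutator term of the exact Hessian at `U′ ≠ 1` (the caveat (ii) of that file's
HONEST SCOPE) is of size `O(|∂U′ − 1|)·‖H_{U′}B′‖²`, hence of the same printed shape `C·m·‖B′‖²` as `E_A`, and is carried by the
same letter — it is NOT produced by the theorems below, which deliver the `∂_{U′}H_{U′} − ∂H` part. -/

/-- Rate weakening of an exponential letter (private plumbing). [folklore] -/
private theorem kernel_weaken_rate {K : g.Site → g.Site → ℝ} {C δ δ' : ℝ} (hC : 0 ≤ C) (hle : δ' ≤ δ)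
    (hd : ∀ a b, 0 ≤ g.dist a b) (hK : ∀ a b, K a b ≤ C * Real.exp (-(δ * g.dist a b))) :
    ∀ a b, K a b ≤ C * Real.exp (-(δ' * g.dist a b)) := fun a b =>
  (hK a b).trans (mul_le_mul_of_nonneg_left (Real.exp_le_exp.mpr (by nlinarith [hd a b])) hC)

/-- **`(QGQ*)⁻¹` at two backgrounds** (Cor. 3.6's operator; steps 1–2 of the assembly): from the letters of `Q`, `G`, `Q*`
at rate `δ` (constants `C_Q, C_G, C_Q`), their differences (`θ_Q, θ_G, θ_Q`), the inverses `W₀, W₁ ≺ C_We^{−δd}` ON THE COARSE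
SUBSPACE (`W₁A₁ = P = A₀W₀`, `W₁P = W₁`, `PW₀ = W₀`, `Aᵢ = QᵢGᵢQ*ᵢ`), and ONE row-sum constant `c` at the step rate `s`
(`4s ≤ δ`): `W₁ − W₀ ≺ C_W²·κ_A·c²·e^{−(δ−4s)d}`, `κ_A = ((θ_QC_G + C_Qθ_G)c·C_Q + C_QC_Gc·θ_Q)·c` (via
`hasL2Majorant_sub_mul3_exp` then `hasL2Majorant_sub_inv_exp`). [cite: Balaban1985BackgroundPropagators, (3.65) p.403,
Cor. 3.6 p.408, (3.126) p.420; Balaban1984PropagatorsII, (2.61) p.234] -/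
theorem hasL2Majorant_qgqInv_sub {G₀ G₁ Q₀ Q₁ Qs₀ Qs₁ W₀ W₁ P : Module.End ℝ (X → ℝ)}
    {KG₀ KG₁ KdG KQ₀ KdQ KQs₁ KdQs KW₀ KW₁ : g.Site → g.Site → ℝ}
    (hG₀ : HasL2Majorant blk G₀ KG₀) (hG₁ : HasL2Majorant blk G₁ KG₁) (hdG : HasL2Majorant blk (G₁ - G₀) KdG)
    (hQ₀ : HasL2Majorant blk Q₀ KQ₀) (hdQ : HasL2Majorant blk (Q₁ - Q₀) KdQ)
    (hQs₁ : HasL2Majorant blk Qs₁ KQs₁) (hdQs : HasL2Majorant blk (Qs₁ - Qs₀) KdQs)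
    (hW₀ : HasL2Majorant blk W₀ KW₀) (hW₁ : HasL2Majorant blk W₁ KW₁)
    (hinv₁ : W₁ * (Q₁ * G₁ * Qs₁) = P) (hinv₀ : (Q₀ * G₀ * Qs₀) * W₀ = P) (hW₁P : W₁ * P = W₁) (hPW₀ : P * W₀ = W₀)
    (hKG₀0 : ∀ a b, 0 ≤ KG₀ a b) (hKG₁0 : ∀ a b, 0 ≤ KG₁ a b) (hKdG0 : ∀ a b, 0 ≤ KdG a b)
    (hKQ₀0 : ∀ a b, 0 ≤ KQ₀ a b) (hKdQ0 : ∀ a b, 0 ≤ KdQ a b) (hKQs₁0 : ∀ a b, 0 ≤ KQs₁ a b)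
    (hKdQs0 : ∀ a b, 0 ≤ KdQs a b) (hKW₀0 : ∀ a b, 0 ≤ KW₀ a b) (hKW₁0 : ∀ a b, 0 ≤ KW₁ a b)
    {CG CQ CW θG θQ δ s c : ℝ} (hCG : 0 ≤ CG) (hCQ : 0 ≤ CQ) (hCW : 0 ≤ CW) (hθG : 0 ≤ θG) (hθQ : 0 ≤ θQ)
    (hc : 0 ≤ c) (hs : 0 ≤ s) (h4s : 4 * s ≤ δ)
    (hKG₀ : ∀ a b, KG₀ a b ≤ CG * Real.exp (-(δ * g.dist a b))) (hKG₁ : ∀ a b, KG₁ a b ≤ CG * Real.exp (-(δ * g.dist a b)))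
    (hKdG : ∀ a b, KdG a b ≤ θG * Real.exp (-(δ * g.dist a b)))
    (hKQ₀ : ∀ a b, KQ₀ a b ≤ CQ * Real.exp (-(δ * g.dist a b))) (hKdQ : ∀ a b, KdQ a b ≤ θQ * Real.exp (-(δ * g.dist a b)))
    (hKQs₁ : ∀ a b, KQs₁ a b ≤ CQ * Real.exp (-(δ * g.dist a b)))
    (hKdQs : ∀ a b, KdQs a b ≤ θQ * Real.exp (-(δ * g.dist a b)))
    (hKW₀ : ∀ a b, KW₀ a b ≤ CW * Real.exp (-(δ * g.dist a b))) (hKW₁ : ∀ a b, KW₁ a b ≤ CW * Real.exp (-(δ * g.dist a b)))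
    (hd : ∀ a b, 0 ≤ g.dist a b) (htri : ∀ a b e, g.dist a e ≤ g.dist a b + g.dist b e)
    (hrow : ∀ y, ∑ y'' : g.Site, Real.exp (-(s * g.dist y y'')) ≤ c) :
    HasL2Majorant blk (W₁ - W₀) (fun a b =>
      CW ^ 2 * (((θQ * CG + CQ * θG) * c * CQ + CQ * CG * c * θQ) * c) * c ^ 2 *
        Real.exp (-((δ - s - s - s - s) * g.dist a b))) := by
  have hrow' : ∀ (r : ℝ) (y : g.Site), ∑ y'' : g.Site, Real.exp (-((r - (r - s)) * g.dist y y'')) ≤ c := by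
    intro r y; have e : r - (r - s) = s := by ring
    rw [e]; exact hrow y
  -- step 1: A₁ − A₀, rates δ → δ−s → δ−2s
  have h1 := hasL2Majorant_sub_mul3_exp blk (T₀ := Q₀) (T₁ := Q₁) (S₀ := G₀) (S₁ := G₁) (R₀ := Qs₀) (R₁ := Qs₁)
    hdQ hG₁ hQ₀ hdG hG₀ hQs₁ hdQs hKdQ0 hKG₁0 hKQ₀0 hKdG0 hKG₀0 hKQs₁0 hKdQs0 hCQ hCG hCQ hθQ hθG hθQ hc
    hKdQ hKG₁ hKQ₀ hKdG hKG₀ hKQs₁ hKdQs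
    (by linarith : 0 ≤ δ - s - s) (by linarith : δ - s - s ≤ δ - s) (by linarith : δ - s ≤ δ) hd htri
    (hrow' δ) (hrow' (δ - s))
  -- step 2: W₁ − W₀, base δ−2s → δ−3s → δ−4s
  have hκA0 : 0 ≤ ((θQ * CG + CQ * θG) * c * CQ + CQ * CG * c * θQ) * c := by positivity
  have hW₁' := kernel_weaken_rate hCW (by linarith : δ - s - s ≤ δ) hd hKW₁
  have hW₀' := kernel_weaken_rate hCW (by linarith : δ - s - s ≤ δ) hd hKW₀
  exact hasL2Majorant_sub_inv_exp blk (A₀ := Q₀ * G₀ * Qs₀) (A₁ := Q₁ * G₁ * Qs₁) (B₀ := W₀) (B₁ := W₁) (P := P)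
    hinv₁ hinv₀ hW₁P hPW₀ hW₁ h1 hW₀ hKW₁0 (fun a b => by positivity) hKW₀0 hCW hκA0 hc hW₁' (fun a b => le_rfl) hW₀'
    (by linarith : 0 ≤ δ - s - s - s - s) (by linarith : δ - s - s - s - s ≤ δ - s - s - s)
    (by linarith : δ - s - s - s ≤ δ - s - s) hd htri (hrow' (δ - s - s)) (hrow' (δ - s - s - s))

/-- **`H = G·Q*·(QGQ*)⁻¹` at two backgrounds from a `(QGQ*)⁻¹`-difference letter** (steps 3–4): letters of `G`, `Q*`, `W`
at a base rate `ρ` (constants `C_G, C_Q, C_W`), differences `θ_G, θ_Q, θ_W`, one row-sum constant `c` at the step rate `s`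
(`2s ≤ ρ`): `G₁Q*₁W₁ − G₀Q*₀W₀ ≺ κ_H·e^{−(ρ−2s)d}`, `κ_H = (θ_G·C_QC_Wc + C_G·(θ_QC_W + C_Qθ_W)c)·c`.
[cite: Balaban1985BackgroundPropagators, (3.65) p.403, (3.126) p.420; Balaban1984PropagatorsII, (2.55) p.232, (2.61) p.234] -/
theorem hasL2Majorant_hOp_sub_of_letters {G₀ G₁ Qs₀ Qs₁ W₀ W₁ : Module.End ℝ (X → ℝ)}
    {KG₀ KdG KQs₀ KQs₁ KdQs KW₁ KdW : g.Site → g.Site → ℝ}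
    (hG₀ : HasL2Majorant blk G₀ KG₀) (hdG : HasL2Majorant blk (G₁ - G₀) KdG)
    (hQs₀ : HasL2Majorant blk Qs₀ KQs₀) (hQs₁ : HasL2Majorant blk Qs₁ KQs₁) (hdQs : HasL2Majorant blk (Qs₁ - Qs₀) KdQs)
    (hW₁ : HasL2Majorant blk W₁ KW₁) (hdW : HasL2Majorant blk (W₁ - W₀) KdW)
    (hKG₀0 : ∀ a b, 0 ≤ KG₀ a b) (hKdG0 : ∀ a b, 0 ≤ KdG a b)
    (hKQs₀0 : ∀ a b, 0 ≤ KQs₀ a b) (hKQs₁0 : ∀ a b, 0 ≤ KQs₁ a b) (hKdQs0 : ∀ a b, 0 ≤ KdQs a b)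
    (hKW₁0 : ∀ a b, 0 ≤ KW₁ a b) (hKdW0 : ∀ a b, 0 ≤ KdW a b)
    {CG CQ CW θG θQ θW ρ s c : ℝ} (hCG : 0 ≤ CG) (hCQ : 0 ≤ CQ) (hCW : 0 ≤ CW) (hθG : 0 ≤ θG) (hθQ : 0 ≤ θQ)
    (hθW : 0 ≤ θW) (hc : 0 ≤ c) (hs : 0 ≤ s) (h2s : 2 * s ≤ ρ)
    (hKG₀ : ∀ a b, KG₀ a b ≤ CG * Real.exp (-(ρ * g.dist a b)))
    (hKdG : ∀ a b, KdG a b ≤ θG * Real.exp (-(ρ * g.dist a b)))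
    (hKQs₀ : ∀ a b, KQs₀ a b ≤ CQ * Real.exp (-(ρ * g.dist a b))) (hKQs₁ : ∀ a b, KQs₁ a b ≤ CQ * Real.exp (-(ρ * g.dist a b)))
    (hKdQs : ∀ a b, KdQs a b ≤ θQ * Real.exp (-(ρ * g.dist a b)))
    (hKW₁ : ∀ a b, KW₁ a b ≤ CW * Real.exp (-(ρ * g.dist a b))) (hKdW : ∀ a b, KdW a b ≤ θW * Real.exp (-(ρ * g.dist a b)))
    (hd : ∀ a b, 0 ≤ g.dist a b) (htri : ∀ a b e, g.dist a e ≤ g.dist a b + g.dist b e)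
    (hrow : ∀ y, ∑ y'' : g.Site, Real.exp (-(s * g.dist y y'')) ≤ c) :
    HasL2Majorant blk (G₁ * (Qs₁ * W₁) - G₀ * (Qs₀ * W₀)) (fun a b =>
      (θG * (CQ * CW * c) + CG * ((θQ * CW + CQ * θW) * c)) * c * Real.exp (-((ρ - s - s) * g.dist a b))) := by
  have hrow' : ∀ (r : ℝ) (y : g.Site), ∑ y'' : g.Site, Real.exp (-((r - (r - s)) * g.dist y y'')) ≤ c := by
    intro r y; have e : r - (r - s) = s := by ring
    rw [e]; exact hrow y
  -- step 3: E₁ − E₀ with E = Q*·W, base ρ → ρ−s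
  have h3 := hasL2Majorant_sub_mul_exp blk (T₀ := Qs₀) (T₁ := Qs₁) (S₀ := W₀) (S₁ := W₁) hdQs hW₁ hQs₀ hdW
    hKdQs0 hKW₁0 hKQs₀0 hKdW0 hCW hCQ hθQ hθW hKdQs hKW₁ hKQs₀ hKdW
    (by linarith : 0 ≤ ρ - s) (by linarith : ρ - s ≤ ρ) hd htri (hrow' ρ)
  have h3E₁ := hasL2Majorant_mul_exp blk hQs₁ hW₁ hKQs₁0 hKW₁0 hCQ hCW hKQs₁ hKW₁
    (by linarith : 0 ≤ ρ - s) (by linarith : ρ - s ≤ ρ) hd htri (hrow' ρ)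
  -- step 4: H₁ − H₀ with H = G·E, base ρ−s → ρ−2s
  have hG₀' := kernel_weaken_rate hCG (by linarith : ρ - s ≤ ρ) hd hKG₀
  have hdG' := kernel_weaken_rate hθG (by linarith : ρ - s ≤ ρ) hd hKdG
  have hκE0 : 0 ≤ (θQ * CW + CQ * θW) * c := by positivity
  have hCE0 : 0 ≤ CQ * CW * c := by positivity
  exact hasL2Majorant_sub_mul_exp blk (T₀ := G₀) (T₁ := G₁) (S₀ := Qs₀ * W₀) (S₁ := Qs₁ * W₁) hdG h3E₁ hG₀ h3
    hKdG0 (fun a b => by positivity) hKG₀0 (fun a b => by positivity) hCE0 hCG hθG hκE0 hdG' (fun a b => le_rfl) hG₀'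
    (fun a b => le_rfl) (by linarith : 0 ≤ ρ - s - s) (by linarith : ρ - s - s ≤ ρ - s) hd htri (hrow' (ρ - s))

/-- **The linearised curvature `T = ∂H` at two backgrounds from an `H`-difference letter** (step 5): letters of `∂`, `H` at
a base rate `ρ` (`C_∂, C_H`), differences `θ_∂` (local, `O(1)ηα₁`) and `θ_H` (the previous theorem), row-sum `c` at the step
rate `s ≤ ρ` ⇒ `∂₁H₁ − ∂₀H₀ ≺ (θ_∂C_H + C_∂θ_H)c·e^{−(ρ−s)d}` = the letter `K_A ≤ C_B·m·e^{−δ_Ad}` of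
`B16Ineq17MinimizerError.ineq17_of_majorants_only` (every θ is `O(α₁)`, `α₁` the size of `A₀`).
[cite: Balaban1989LargeFieldII, p.357; Balaban1985BackgroundPropagators, (3.65) p.403] -/
theorem hasL2Majorant_curvature_sub_of_letters {D₀ D₁ H₀ H₁ : Module.End ℝ (X → ℝ)}
    {KD₀ KdD KH₁ KdH : g.Site → g.Site → ℝ}
    (hD₀ : HasL2Majorant blk D₀ KD₀) (hdD : HasL2Majorant blk (D₁ - D₀) KdD) (hH₁ : HasL2Majorant blk H₁ KH₁)
    (hdH : HasL2Majorant blk (H₁ - H₀) KdH)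
    (hKD₀0 : ∀ a b, 0 ≤ KD₀ a b) (hKdD0 : ∀ a b, 0 ≤ KdD a b) (hKH₁0 : ∀ a b, 0 ≤ KH₁ a b) (hKdH0 : ∀ a b, 0 ≤ KdH a b)
    {CD CH θD θH ρ s c : ℝ} (hCD : 0 ≤ CD) (hCH : 0 ≤ CH) (hθD : 0 ≤ θD) (hθH : 0 ≤ θH) (hs : 0 ≤ s) (hsρ : s ≤ ρ)
    (hKD₀ : ∀ a b, KD₀ a b ≤ CD * Real.exp (-(ρ * g.dist a b))) (hKdD : ∀ a b, KdD a b ≤ θD * Real.exp (-(ρ * g.dist a b)))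
    (hKH₁ : ∀ a b, KH₁ a b ≤ CH * Real.exp (-(ρ * g.dist a b))) (hKdH : ∀ a b, KdH a b ≤ θH * Real.exp (-(ρ * g.dist a b)))
    (hd : ∀ a b, 0 ≤ g.dist a b) (htri : ∀ a b e, g.dist a e ≤ g.dist a b + g.dist b e)
    (hrow : ∀ y, ∑ y'' : g.Site, Real.exp (-(s * g.dist y y'')) ≤ c) :
    HasL2Majorant blk (D₁ * H₁ - D₀ * H₀) (fun a b => (θD * CH + CD * θH) * c * Real.exp (-((ρ - s) * g.dist a b))) := by
  have hrow' : ∀ y : g.Site, ∑ y'' : g.Site, Real.exp (-((ρ - (ρ - s)) * g.dist y y'')) ≤ c := by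
    intro y; have e : ρ - (ρ - s) = s := by ring
    rw [e]; exact hrow y
  exact hasL2Majorant_sub_mul_exp blk hdD hH₁ hD₀ hdH hKdD0 hKH₁0 hKD₀0 hKdH0 hCH hCD hθD hθH hKdD hKH₁ hKD₀ hKdH
    (by linarith : 0 ≤ ρ - s) (by linarith : ρ - s ≤ ρ) hd htri hrow'

end Literature.MathematicalPhysics.QuantumFieldTheory.Balaban1983to89.B9Eq365DifferenceMajorants

end
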